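import Mathlib.MeasureTheory.Integral.DominatedConvergence
import Literature.Probability.RandomPlanarGeometry.SLEOnePointMartingale
import Literature.Probability.RandomPlanarGeometry.SLECrossingProbabilityProofs
import Literature.Analysis.FunctionSpaces.ItoProcessesProofs
import HarnessLib

/-!
# A.s. swallowing of real points for `κ > 4` from Lawler's one-point martingales

Topic `Probability/RandomPlanarGeometry`; theorems only (proof sibling of `SLEOnePointMartingale`).
From the two Itô steps `Literature.Probability.RandomPlanarGeometry.sle_martingale_onePointPow` (`(X_{t∧σ})^{1-4/κ}` is a martingale) and
`Literature.Probability.RandomPlanarGeometry.sle_martingale_onePointSq` (`(X_{t∧σ})² - (4+κ)(t∧σ)` is a martingale) we prove, following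
Lawler (2005), proof of Prop. 1.21 (optional stopping, then `x₂ → ∞`) and Prop. 6.8:

**for `κ > 4` and `x > 0`, almost surely `T_x < ∞`** (`Literature.Probability.RandomPlanarGeometry.sle_swallowingTime_lt_top_of_onePointMartingales`).

Steps (`σ = σ_R` the exit time of the frozen flow `X` from `(0, R)`, `R > x`; `q = 1 - 4/κ ∈ (0,1)`):
1. pathwise: `X` (frozen at `0` from `T_x` on) is continuous, `X > 0` exactly before `T_x`, the exit
   time of `(0, R)` is `T_x ∧ ρ_R` (`ρ_R` the hitting time of level `R`), `0 ≤ X_{t∧σ} ≤ R`, and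
   `X_σ ∈ {0, R}` when `σ < ∞`;
2. from the quadratic martingale: `(4+κ) E[t ∧ σ] = E[X²_{t∧σ}] - x² ≤ R²`, so `P{σ = ∞} = 0`;
3. from the power martingale: `E[X^q_{t∧σ}] = x^q`; letting `t → ∞` (dominated convergence, `σ < ∞`
   a.s.): `R^q P{X_σ = R} = x^q`;
4. `{T_x = ∞} ⊆ {X_σ = R} ∪ {σ = ∞}`, so `P{T_x = ∞} ≤ (x/R)^q → 0` as `R → ∞`.

Consequently Cardy's formula for SLE₆ follows from three Itô-formula outputs alone
(`CritPerc.sle_six_measureReal_hitsBefore_of_itoSteps`): the two-point (local) martingale of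
`SLETwoPointMartingale` and the two one-point martingales of `SLEOnePointMartingale`.

## References

* G. F. Lawler, *Conformally Invariant Processes in the Plane* (2005), §1.10, proof of Prop. 1.21;
  §6.2, Prop. 6.8.
* S. Rohde, O. Schramm, *Basic properties of SLE*, Ann. of Math. 161 (2005), Lemma 6.5.
-/

noncomputable section

open Set Filter Topology MeasureTheory Complex
open scoped NNReal ENNReal

namespace Literature.Probability.RandomPlanarGeometry

namespace Loewner

variable {W : ℝ≥0 → ℝ} {x : ℝ}

/-! ### The frozen real flow along one path -/

/-- The frozen flow is positive exactly before the swallowing time (`x > W₀`). [folklore] -/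
theorem realFlowStop_pos_iff (hW : Continuous W) (hx : W 0 < x) {t : ℝ≥0} :
    0 < realFlowStop W x t ↔ (t : WithTop ℝ≥0) < swallowingTime W x := by
  constructor
  · intro h
    by_contra hle
    rw [realFlowStop_of_le (not_lt.1 hle)] at h
    exact lt_irrefl _ h
  · intro h
    rw [realFlowStop_of_lt h]
    exact realFlow_pos hW hx h

/-- The frozen flow is nonnegative (`x > W₀`). [folklore] -/
theorem realFlowStop_nonneg (hW : Continuous W) (hx : W 0 < x) (t : ℝ≥0) : 0 ≤ realFlowStop W x t := by
  by_cases h : (t : WithTop ℝ≥0) < swallowingTime W x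
  · exact ((realFlowStop_pos_iff hW hx).2 h).le
  · rw [realFlowStop_of_le (not_lt.1 h)]

/-- The frozen flow starts at `x - W₀`. [folklore] -/
theorem realFlowStop_zero (hW : Continuous W) (hx : W 0 < x) : realFlowStop W x 0 = x - W 0 := by
  have hx' : (x : ℂ) ≠ W 0 := fun h ↦ hx.ne' (by exact_mod_cast h)
  rw [realFlowStop_of_lt (by exact_mod_cast swallowingTime_pos_holds hW hx'), realFlow_zero hW hx.ne']

/-- **The frozen flow is continuous** (`W` continuous, `x > W₀`): continuous before `T_x`
(`continuousOn_realFlow`), identically `0` after, and `X_{T_x-} = 0`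
(`realFlow_lt_of_near_swallowingTime`). [folklore] -/
theorem continuous_realFlowStop (hW : Continuous W) (hx : W 0 < x) : Continuous (realFlowStop W x) := by
  have hx' : (x : ℂ) ≠ W 0 := fun h ↦ hx.ne' (by exact_mod_cast h)
  set T := swallowingTime W x with hTdef
  have hU : ContinuousOn (realFlowStop W x) {s | (s : WithTop ℝ≥0) < T} :=
    (continuousOn_realFlow hW hx').congr fun s hs ↦ realFlowStop_of_lt hs
  rw [continuous_iff_continuousAt]
  intro t
  by_cases ht : (t : WithTop ℝ≥0) < T
  · exact hU.continuousAt ((isOpen_setOf_coe_lt T).mem_nhds ht)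
  rw [not_lt] at ht
  obtain ⟨b, hb⟩ := WithTop.ne_top_iff_exists.1 (ne_top_of_le_ne_top WithTop.coe_ne_top ht)
  have hbt : b ≤ t := by rw [← hb] at ht; exact_mod_cast ht
  have hzero : ∀ s : ℝ≥0, b ≤ s → realFlowStop W x s = 0 := fun s hs ↦
    realFlowStop_of_le (by rw [← hTdef, ← hb]; exact_mod_cast hs)
  rcases hbt.lt_or_eq with hbt | hbt
  · refine (continuousAt_const (y := (0 : ℝ))).congr ?_
    filter_upwards [Ioi_mem_nhds hbt] with s hs
    exact (hzero s hs.le).symm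
  subst hbt
  rw [continuousAt_iff_continuous_left'_right']
  refine ⟨?_, (continuousWithinAt_const (b := (0 : ℝ))).congr (fun s hs ↦ hzero s (le_of_lt hs))
    (hzero b le_rfl)⟩
  rw [ContinuousWithinAt, hzero b le_rfl, Metric.tendsto_nhdsWithin_nhds]
  intro ε hε
  obtain ⟨s₀, hs₀b, hs₀⟩ := realFlow_lt_of_near_swallowingTime hW hx hb.symm hε
  refine ⟨(b : ℝ) - s₀, sub_pos.2 (NNReal.coe_lt_coe.2 hs₀b), fun s hs hdist ↦ ?_⟩
  have hsb : s < b := hs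
  rw [NNReal.dist_eq, abs_sub_comm, abs_of_nonneg (sub_nonneg.2 (NNReal.coe_le_coe.2 hsb.le))] at hdist
  have hs₀s : s₀ ≤ s := NNReal.coe_le_coe.1 (by linarith)
  have hsT : (s : WithTop ℝ≥0) < swallowingTime W x := by
    rw [← hTdef, ← hb]; exact_mod_cast hsb
  rw [Real.dist_eq, sub_zero, realFlowStop_of_lt hsT, abs_of_pos (realFlow_pos hW hx hsT)]
  exact hs₀ s hs₀s hsb

/-- The complexified frozen flow is a continuous path. [folklore] -/
theorem continuous_realFlowStop_ofReal (hW : Continuous W) (hx : W 0 < x) :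
    Continuous fun t ↦ ((realFlowStop W x t : ℝ) : ℂ) :=
  continuous_ofReal.comp (continuous_realFlowStop hW hx)

/-! ### Hitting times of the frozen flow -/

/-- **The lower hitting time of level `0` is the swallowing time** (`x > W₀`): the frozen flow is
positive exactly before `T_x` and vanishes at `T_x`. [cite: Lawler2005, Prop. 1.21] -/
theorem lowerTime_zero_eq (hW : Continuous W) (hx : W 0 < x) : lowerTime W x 0 = swallowingTime W x := by
  apply le_antisymm
  · -- if `T_x = b < ⊤` then the flow vanishes at `b`
    by_cases hT : swallowingTime W x = ⊤
    · rw [hT]; exact le_top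
    · obtain ⟨b, hb⟩ := WithTop.ne_top_iff_exists.1 hT
      rw [← hb]
      refine firstHit_le ?_
      show ((realFlowStop W x b : ℝ) : ℂ).re ≤ 0
      rw [ofReal_re, realFlowStop_of_le hb.symm.le]
  · -- before `T_x` the flow is positive, so not yet hit
    rw [lowerTime, firstHit]
    refine le_sInf ?_
    rintro _ ⟨t, ht, rfl⟩
    by_contra hlt
    rw [not_le] at hlt
    have h1 := (realFlowStop_pos_iff hW hx).2 hlt
    have h2 : realFlowStop W x t ≤ 0 := by simpa using ht
    linarith

/-- Before the upper hitting time the frozen flow is below the level. [folklore] -/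
theorem realFlowStop_lt_of_lt_levelTime {x₂ : ℝ} {t : ℝ≥0} (ht : (t : WithTop ℝ≥0) < levelTime W x x₂) :
    realFlowStop W x t < x₂ := by
  have := notMem_of_lt_firstHit ht
  simpa [not_le] using this

/-- The upper hitting time of a level above the starting value is positive. [folklore] -/
theorem levelTime_pos (hW : Continuous W) (hx : W 0 < x) {x₂ : ℝ} (hx₂ : x - W 0 < x₂) :
    0 < levelTime W x x₂ := by
  have hopen : IsOpen {s : ℝ≥0 | realFlowStop W x s < x₂} :=
    isOpen_lt (continuous_realFlowStop hW hx) continuous_const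
  have h0 : (0 : ℝ≥0) ∈ {s : ℝ≥0 | realFlowStop W x s < x₂} := by
    rw [mem_setOf_eq, realFlowStop_zero hW hx]; exact hx₂
  obtain ⟨ε, hε, hball⟩ := Metric.isOpen_iff.1 hopen 0 h0
  set η : ℝ≥0 := (ε / 2).toNNReal with hη
  have hηpos : 0 < η := Real.toNNReal_pos.2 (half_pos hε)
  have hηle : (η : WithTop ℝ≥0) ≤ levelTime W x x₂ := by
    rw [levelTime, firstHit]
    refine le_sInf ?_
    rintro _ ⟨t, ht, rfl⟩
    rw [WithTop.coe_le_coe]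
    by_contra hlt
    rw [not_le, hη, Real.lt_toNNReal_iff_coe_lt] at hlt
    have htball : t ∈ Metric.ball (0 : ℝ≥0) ε := by
      rw [Metric.mem_ball, NNReal.dist_eq, NNReal.coe_zero, sub_zero, abs_of_nonneg t.coe_nonneg]
      linarith
    have h1 : realFlowStop W x t < x₂ := hball htball
    have h2 : x₂ ≤ realFlowStop W x t := by simpa using ht
    linarith
  exact lt_of_lt_of_le (by exact_mod_cast hηpos) hηle

/-- **At the upper hitting time the frozen flow equals the level** (`W` continuous, `x > W₀`,
level above the start): the level is attained (closed target, continuous path) and not exceeded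
(below the level just before). [folklore] -/
theorem realFlowStop_levelTime_eq (hW : Continuous W) (hx : W 0 < x) {x₂ : ℝ} (hx₂ : x - W 0 < x₂)
    {b : ℝ≥0} (hb : levelTime W x x₂ = b) : realFlowStop W x b = x₂ := by
  have hclosed : IsClosed {z : ℂ | x₂ ≤ z.re} := isClosed_le continuous_const continuous_re
  obtain ⟨t₀, ht₀, hmem⟩ := exists_firstHit_eq_coe (S := {z : ℂ | x₂ ≤ z.re})
    (continuous_realFlowStop_ofReal hW hx) hclosed (by rw [← levelTime, hb]; exact WithTop.coe_ne_top)
  rw [← levelTime, hb, WithTop.coe_eq_coe] at ht₀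
  subst ht₀
  have hge : x₂ ≤ realFlowStop W x b := by simpa using hmem
  -- `≤`: the flow is `< x₂` on `[0, b)` and continuous at `b > 0`
  have hb0 : 0 < b := by
    have := levelTime_pos hW hx hx₂
    rw [hb] at this
    exact_mod_cast this
  have hle : realFlowStop W x b ≤ x₂ := by
    have hcw : ContinuousWithinAt (realFlowStop W x) (Iio b) b :=
      (continuous_realFlowStop hW hx).continuousWithinAt
    have hcl : b ∈ closure (Iio b) := by
      rw [closure_Iio' (show (Iio b : Set ℝ≥0).Nonempty from ⟨0, hb0⟩)]; exact (le_rfl : b ≤ b)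
    have hmem' := hcw.mem_closure_image hcl
    have hsub : realFlowStop W x '' Iio b ⊆ Iio x₂ := by
      rintro _ ⟨s, hs, rfl⟩
      exact realFlowStop_lt_of_lt_levelTime (by rw [hb]; exact_mod_cast hs)
    have := closure_mono hsub hmem'
    rw [closure_Iio] at this
    exact this
  exact le_antisymm hle hge

/-- The exit time of `(0, x₂)` is `T_x ∧ levelTime` (`x > W₀`). [cite: Lawler2005, Prop. 1.21] -/
theorem exitTime_zero_eq (hW : Continuous W) (hx : W 0 < x) (x₂ : ℝ) :
    exitTime W x 0 x₂ = min (swallowingTime W x) (levelTime W x x₂) := by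
  rw [exitTime, lowerTime_zero_eq hW hx]

/-- **Exit values**: if the exit time of `(0, x₂)` is finite, `σ = b`, then `X_b ∈ {0, x₂}`
(`0` if the point was swallowed first, `x₂` if the level was reached first).
[cite: Lawler2005, Prop. 1.21] -/
theorem realFlowStop_exitTime (hW : Continuous W) (hx : W 0 < x) {x₂ : ℝ} (hx₂ : x - W 0 < x₂)
    {b : ℝ≥0} (hb : exitTime W x 0 x₂ = b) :
    realFlowStop W x b = 0 ∨ realFlowStop W x b = x₂ := by
  rw [exitTime_zero_eq hW hx] at hb
  rcases le_total (swallowingTime W x) (levelTime W x x₂) with h | h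
  · rw [min_eq_left h] at hb
    exact Or.inl (realFlowStop_of_le hb.le)
  · rw [min_eq_right h] at hb
    exact Or.inr (realFlowStop_levelTime_eq hW hx hx₂ hb)

/-- If the point is never swallowed but the exit time of `(0, x₂)` is finite, the exit is through
the level: `X_σ = x₂`. [cite: Lawler2005, Prop. 1.21] -/
theorem realFlowStop_exitTime_of_top (hW : Continuous W) (hx : W 0 < x) {x₂ : ℝ} (hx₂ : x - W 0 < x₂)
    (hT : swallowingTime W x = ⊤) {b : ℝ≥0} (hb : exitTime W x 0 x₂ = b) :
    realFlowStop W x b = x₂ := by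
  rw [exitTime_zero_eq hW hx, hT, min_eq_right le_top] at hb
  exact realFlowStop_levelTime_eq hW hx hx₂ hb

/-- **Bounds on the stopped frozen flow**: `0 ≤ X_{t∧σ} ≤ x₂` for the exit time `σ` of `(0, x₂)`.
[cite: Lawler2005, Prop. 1.21] -/
theorem realFlowStop_untopA_mem_Icc (hW : Continuous W) (hx : W 0 < x) {x₂ : ℝ} (hx₂ : x - W 0 < x₂)
    (t : ℝ≥0) :
    realFlowStop W x (min (t : WithTop ℝ≥0) (exitTime W x 0 x₂)).untopA ∈ Icc (0 : ℝ) x₂ := by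
  set m := (min (t : WithTop ℝ≥0) (exitTime W x 0 x₂)).untopA with hm
  refine ⟨realFlowStop_nonneg hW hx m, ?_⟩
  have hne : min (t : WithTop ℝ≥0) (exitTime W x 0 x₂) ≠ ⊤ :=
    ne_top_of_le_ne_top WithTop.coe_ne_top (min_le_left _ _)
  have hmσ : (m : WithTop ℝ≥0) ≤ exitTime W x 0 x₂ := by
    rw [hm, WithTop.untopA_eq_untop hne, WithTop.coe_untop]; exact min_le_right _ _
  have hmL : (m : WithTop ℝ≥0) ≤ levelTime W x x₂ := hmσ.trans (exitTime_le_levelTime x 0 x₂)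
  rcases hmL.lt_or_eq with hlt | heq
  · exact (realFlowStop_lt_of_lt_levelTime hlt).le
  · exact (realFlowStop_levelTime_eq hW hx hx₂ heq.symm).le

end Loewner


/-! ### The SLE_κ one-point observables: values, bounds, measurability -/

section SLE

open Loewner

variable {κ : ℝ≥0} {x R : ℝ}

/-- `((0 : ℝ≥0) : WithTop ℝ≥0)` is below every random time. [folklore] -/
theorem coe_zero_le_withTop (τ : WithTop ℝ≥0) : ((0 : ℝ≥0) : WithTop ℝ≥0) ≤ τ :=
  WithTop.coe_le_iff.2 fun _ _ ↦ zero_le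

/-- The stopped frozen flow at time `0` is `x` (SLE: `W₀ = 0`). [folklore] -/
theorem stoppedProcess_sleRealFlowStop_zero (hx : 0 < x) (R : ℝ) (ω : ℝ≥0 → ℝ) :
    stoppedProcess (sleRealFlowStop κ x) (sleExitTime κ x 0 R) 0 ω = x := by
  rw [stoppedProcess, min_eq_left (coe_zero_le_withTop _), WithTop.untopA_eq_untop WithTop.coe_ne_top,
    WithTop.untop_coe, sleRealFlowStop, realFlowStop_zero (continuous_sleDriving κ ω)
      (by rwa [sleDriving_zero]), sleDriving_zero, sub_zero]

/-- `(t ∧ σ)` at `t = 0` is `0`. [folklore] -/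
theorem untopA_min_zero (τ : WithTop ℝ≥0) : (min ((0 : ℝ≥0) : WithTop ℝ≥0) τ).untopA = 0 := by
  rw [min_eq_left (coe_zero_le_withTop τ), WithTop.untopA_eq_untop WithTop.coe_ne_top, WithTop.untop_coe]

/-- The quadratic observable starts at `x²`. [cite: Lawler2005, Prop. 1.21] -/
theorem sleOnePointSq_zero (hx : 0 < x) (R : ℝ) (ω : ℝ≥0 → ℝ) : sleOnePointSq κ x 0 R 0 ω = x ^ 2 := by
  rw [sleOnePointSq, stoppedProcess_sleRealFlowStop_zero hx, sleExitTime, untopA_min_zero]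
  simp

/-- The power observable starts at `x^{1-4/κ}`. [cite: Lawler2005, Prop. 1.21] -/
theorem sleOnePointPow_zero (hx : 0 < x) (R : ℝ) (ω : ℝ≥0 → ℝ) :
    sleOnePointPow κ x 0 R 0 ω = x ^ (1 - 4 / (κ : ℝ)) := by
  rw [sleOnePointPow, stoppedProcess_sleRealFlowStop_zero hx]

/-- **`0 ≤ X_{t∧σ} ≤ R`** for the exit time `σ` of `(0, R)`, `0 < x < R`, every sample path.
[cite: Lawler2005, Prop. 1.21] -/
theorem stoppedProcess_sleRealFlowStop_mem_Icc (hx : 0 < x) (hR : x < R) (t : ℝ≥0) (ω : ℝ≥0 → ℝ) :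
    stoppedProcess (sleRealFlowStop κ x) (sleExitTime κ x 0 R) t ω ∈ Icc (0 : ℝ) R := by
  rw [stoppedProcess, sleRealFlowStop, sleExitTime]
  exact realFlowStop_untopA_mem_Icc (continuous_sleDriving κ ω) (by rwa [sleDriving_zero])
    (by rw [sleDriving_zero, sub_zero]; exact hR) t

/-- The power observable lies in `[0, R^{1-4/κ}]` (`κ > 4`, `0 < x < R`). [cite: Lawler2005, Prop. 1.21] -/
theorem sleOnePointPow_mem_Icc (hκ : 4 < κ) (hx : 0 < x) (hR : x < R) (t : ℝ≥0) (ω : ℝ≥0 → ℝ) :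
    sleOnePointPow κ x 0 R t ω ∈ Icc (0 : ℝ) (R ^ (1 - 4 / (κ : ℝ))) := by
  have hq : 0 < 1 - 4 / (κ : ℝ) := by
    have hκ' : (4 : ℝ) < κ := by exact_mod_cast hκ
    rw [sub_pos, div_lt_one (by linarith)]; exact hκ'
  have hm := stoppedProcess_sleRealFlowStop_mem_Icc (κ := κ) hx hR t ω
  rw [sleOnePointPow]
  exact ⟨Real.rpow_nonneg hm.1 _, Real.rpow_le_rpow hm.1 hm.2 hq.le⟩

/-- The constancy of expectations along a martingale (`∫ M_t = ∫ M_0`; Mathlib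
`Martingale.setIntegral_eq` on `univ`). [folklore] -/
theorem integral_eq_of_martingale {M : ℝ≥0 → (ℝ≥0 → ℝ) → ℝ} [IsFiniteMeasure Process.preWienerMeasure]
    (hM : Martingale M brownianFiltration Process.preWienerMeasure) (t : ℝ≥0) :
    ∫ ω, M t ω ∂Process.preWienerMeasure = ∫ ω, M 0 ω ∂Process.preWienerMeasure := by
  have h1 := hM.setIntegral_eq (zero_le : (0 : ℝ≥0) ≤ t) (s := univ) MeasurableSet.univ
  rw [setIntegral_univ, setIntegral_univ] at h1
  exact h1.symm

/-- The stopped frozen flow is the `(1-4/κ)⁻¹`-th power of the power observable (base `≥ 0`), hence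
measurable whenever the latter is. [folklore] -/
theorem stoppedProcess_eq_sleOnePointPow_rpow (hκ : 4 < κ) (hx : 0 < x) (hR : x < R) (t : ℝ≥0)
    (ω : ℝ≥0 → ℝ) :
    stoppedProcess (sleRealFlowStop κ x) (sleExitTime κ x 0 R) t ω =
      sleOnePointPow κ x 0 R t ω ^ (1 - 4 / (κ : ℝ))⁻¹ := by
  have hq : 1 - 4 / (κ : ℝ) ≠ 0 := by
    have hκ' : (4 : ℝ) < κ := by exact_mod_cast hκ
    have : 0 < 1 - 4 / (κ : ℝ) := by rw [sub_pos, div_lt_one (by linarith)]; exact hκ'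
    exact this.ne'
  rw [sleOnePointPow, Real.rpow_rpow_inv (stoppedProcess_sleRealFlowStop_mem_Icc hx hR t ω).1 hq]

/-- Measurability of the stopped frozen flow, from the power martingale. [folklore] -/
theorem measurable_stoppedProcess_sleRealFlowStop (h1 : sle_martingale_onePointPow) (hκ : 4 < κ)
    (hx : 0 < x) (hR : x < R) (t : ℝ≥0) :
    Measurable fun ω ↦ stoppedProcess (sleRealFlowStop κ x) (sleExitTime κ x 0 R) t ω := by
  have hM := h1 hκ le_rfl hx hR
  have hmeas : Measurable (sleOnePointPow κ x 0 R t) :=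
    ((hM.stronglyMeasurable t).mono (brownianFiltration.le t)).measurable
  have e : (fun ω ↦ stoppedProcess (sleRealFlowStop κ x) (sleExitTime κ x 0 R) t ω) =
      fun ω ↦ sleOnePointPow κ x 0 R t ω ^ (1 - 4 / (κ : ℝ))⁻¹ :=
    funext fun ω ↦ stoppedProcess_eq_sleOnePointPow_rpow hκ hx hR t ω
  rw [e]
  exact hmeas.pow_const _

/-- The stopped clock `t ∧ σ` (read in `ℝ`), as a function of `ω`. [folklore] -/
theorem untopA_min_eq_of_sq (t : ℝ≥0) (ω : ℝ≥0 → ℝ) (hκ0 : 0 < (κ : ℝ)) :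
    (((min (t : WithTop ℝ≥0) (sleExitTime κ x 0 R ω)).untopA : ℝ≥0) : ℝ) =
      (stoppedProcess (sleRealFlowStop κ x) (sleExitTime κ x 0 R) t ω ^ 2 -
        sleOnePointSq κ x 0 R t ω) / (4 + (κ : ℝ)) := by
  rw [sleOnePointSq]
  field_simp
  ring

/-- Measurability of the stopped clock `ω ↦ t ∧ σ(ω)`, from the two martingales. [folklore] -/
theorem measurable_untopA_min (h1 : sle_martingale_onePointPow) (h2 : sle_martingale_onePointSq)
    (hκ : 4 < κ) (hx : 0 < x) (hR : x < R) (t : ℝ≥0) :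
    Measurable fun ω ↦ (((min (t : WithTop ℝ≥0) (sleExitTime κ x 0 R ω)).untopA : ℝ≥0) : ℝ) := by
  have hκ4 : (4 : ℝ) < κ := by exact_mod_cast hκ
  have hκ0 : 0 < (κ : ℝ) := by linarith
  have hM2 := h2 (lt_trans (by norm_num) hκ) le_rfl hx hR
  have hmeas2 : Measurable (sleOnePointSq κ x 0 R t) :=
    ((hM2.stronglyMeasurable t).mono (brownianFiltration.le t)).measurable
  have e := funext fun ω ↦ untopA_min_eq_of_sq (κ := κ) (x := x) (R := R) t ω hκ0
  rw [show (fun ω ↦ (((min (t : WithTop ℝ≥0) (sleExitTime κ x 0 R ω)).untopA : ℝ≥0) : ℝ)) = _ from e]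
  exact (((measurable_stoppedProcess_sleRealFlowStop h1 hκ hx hR t).pow_const 2).sub hmeas2).div_const _

/-- If `σ = ⊤` the stopped clock is `t`. [folklore] -/
theorem untopA_min_of_eq_top (t : ℝ≥0) {τ : WithTop ℝ≥0} (h : τ = ⊤) :
    (min (t : WithTop ℝ≥0) τ).untopA = t := by
  rw [h, min_eq_left le_top, WithTop.untopA_eq_untop WithTop.coe_ne_top, WithTop.untop_coe]

/-- If `σ = s < t` the stopped clock is `s`. [folklore] -/
theorem untopA_min_of_coe_le (t : ℝ≥0) {τ : WithTop ℝ≥0} {s : ℝ≥0} (h : τ = s) (hst : s ≤ t) :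
    (min (t : WithTop ℝ≥0) τ).untopA = s := by
  rw [h, min_eq_right (WithTop.coe_le_coe.2 hst), WithTop.untopA_eq_untop WithTop.coe_ne_top,
    WithTop.untop_coe]

/-! ### Step 2: the exit time of `(0, R)` is a.s. finite -/

/-- **`E[t ∧ σ] ≤ R²/(4+κ)`** from the quadratic martingale: `(4+κ) E[t∧σ] = E[X²_{t∧σ}] - x² ≤ R²`.
[cite: Lawler2005, Prop. 1.21] -/
theorem integral_untopA_min_le (h1 : sle_martingale_onePointPow) (h2 : sle_martingale_onePointSq)
    (hκ : 4 < κ) (hx : 0 < x) (hR : x < R) (t : ℝ≥0) :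
    ∫ ω, (((min (t : WithTop ℝ≥0) (sleExitTime κ x 0 R ω)).untopA : ℝ≥0) : ℝ) ∂Process.preWienerMeasure ≤
      R ^ 2 / (4 + (κ : ℝ)) := by
  haveI := isProbabilityMeasure_preWienerMeasure'
  have hκ' : (4 : ℝ) < κ := by exact_mod_cast hκ
  have hκ0 : 0 < (κ : ℝ) := by linarith
  have hM2 := h2 (lt_trans (by norm_num) hκ) le_rfl hx hR
  set S : (ℝ≥0 → ℝ) → ℝ := fun ω ↦ stoppedProcess (sleRealFlowStop κ x) (sleExitTime κ x 0 R) t ω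
  set τ : (ℝ≥0 → ℝ) → ℝ := fun ω ↦ (((min (t : WithTop ℝ≥0) (sleExitTime κ x 0 R ω)).untopA : ℝ≥0) : ℝ)
  have hSm : Measurable S := measurable_stoppedProcess_sleRealFlowStop h1 hκ hx hR t
  have hτm : Measurable τ := measurable_untopA_min h1 h2 hκ hx hR t
  have hSbdd : ∀ ω, S ω ^ 2 ≤ R ^ 2 := fun ω ↦ by
    have hm := stoppedProcess_sleRealFlowStop_mem_Icc (κ := κ) hx hR t ω
    exact pow_le_pow_left₀ hm.1 hm.2 2
  have hSint : Integrable (fun ω ↦ S ω ^ 2) Process.preWienerMeasure :=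
    (integrable_const (R ^ 2)).mono' (hSm.pow_const 2).aestronglyMeasurable
      (ae_of_all _ fun ω ↦ by
        rw [Real.norm_eq_abs, abs_of_nonneg (sq_nonneg _)]; exact hSbdd ω)
  have hτbdd : ∀ ω, |τ ω| ≤ t := fun ω ↦ by
    rw [abs_of_nonneg (NNReal.coe_nonneg _)]
    exact_mod_cast Literature.Analysis.FunctionSpaces.untopA_min_le t _
  have hτint : Integrable τ Process.preWienerMeasure :=
    (integrable_const (t : ℝ)).mono' hτm.aestronglyMeasurable
      (ae_of_all _ fun ω ↦ by rw [Real.norm_eq_abs]; exact hτbdd ω)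
  -- `∫ Sq_t = x²` and `Sq_t = S² - (4+κ) τ`
  have hint : ∫ ω, sleOnePointSq κ x 0 R t ω ∂Process.preWienerMeasure = x ^ 2 := by
    rw [integral_eq_of_martingale hM2 t]
    simp_rw [sleOnePointSq_zero (κ := κ) hx R]
    rw [integral_const, smul_eq_mul, probReal_univ, one_mul]
  have hdecomp : ∀ ω, sleOnePointSq κ x 0 R t ω = S ω ^ 2 - (4 + (κ : ℝ)) * τ ω := fun ω ↦ rfl
  simp_rw [hdecomp] at hint
  rw [integral_sub hSint (hτint.const_mul _), integral_const_mul] at hint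
  have hS2 : ∫ ω, S ω ^ 2 ∂Process.preWienerMeasure ≤ R ^ 2 := by
    have := integral_mono hSint (integrable_const (R ^ 2)) fun ω ↦ hSbdd ω
    rwa [integral_const, smul_eq_mul, probReal_univ, one_mul] at this
  rw [le_div_iff₀ (by linarith), mul_comm]
  linarith [sq_nonneg x]

/-- The event `{σ = ⊤}` is measurable: `σ = ⊤` iff the stopped clock `n ∧ σ` equals `n` for
every `n : ℕ`. [folklore] -/
theorem measurableSet_sleExitTime_eq_top (h1 : sle_martingale_onePointPow)
    (h2 : sle_martingale_onePointSq) (hκ : 4 < κ) (hx : 0 < x) (hR : x < R) :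
    MeasurableSet {ω | sleExitTime κ x 0 R ω = ⊤} := by
  have hset : {ω : ℝ≥0 → ℝ | sleExitTime κ x 0 R ω = ⊤} =
      ⋂ n : ℕ, {ω | (((min ((n : ℝ≥0) : WithTop ℝ≥0) (sleExitTime κ x 0 R ω)).untopA : ℝ≥0) : ℝ) = n} := by
    ext ω
    simp only [mem_setOf_eq, mem_iInter]
    constructor
    · intro h n
      rw [untopA_min_of_eq_top _ h]; rfl
    · intro h
      by_contra hne
      obtain ⟨s, hs⟩ := WithTop.ne_top_iff_exists.1 hne
      obtain ⟨n, hn⟩ := exists_nat_gt (s : ℝ)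
      have h1 := h n
      have hsn : s ≤ (n : ℝ≥0) := by
        rw [← NNReal.coe_le_coe]; push_cast; exact hn.le
      rw [untopA_min_of_coe_le _ hs.symm hsn] at h1
      have : (s : ℝ) = n := by exact_mod_cast h1
      linarith
  rw [hset]
  exact MeasurableSet.iInter fun n ↦
    measurableSet_eq_fun (measurable_untopA_min h1 h2 hκ hx hR _) measurable_const

/-- **The exit time of `(0, R)` is a.s. finite** (`κ > 4`, `0 < x < R`): `n · P{σ = ∞} ≤ E[n ∧ σ] ≤
R²/(4+κ)` for every `n`. (Lawler (2005), proof of Prop. 1.21, implicitly; here from the quadratic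
martingale.) [cite: Lawler2005, Prop. 1.21] -/
theorem ae_sleExitTime_lt_top (h1 : sle_martingale_onePointPow) (h2 : sle_martingale_onePointSq)
    (hκ : 4 < κ) (hx : 0 < x) (hR : x < R) :
    ∀ᵐ ω ∂Process.preWienerMeasure, sleExitTime κ x 0 R ω < ⊤ := by
  haveI := isProbabilityMeasure_preWienerMeasure'
  have hκ' : (4 : ℝ) < κ := by exact_mod_cast hκ
  set N := {ω : ℝ≥0 → ℝ | sleExitTime κ x 0 R ω = ⊤} with hNdef
  have hN : MeasurableSet N := measurableSet_sleExitTime_eq_top h1 h2 hκ hx hR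
  have hbound : ∀ n : ℕ, (n : ℝ) * Process.preWienerMeasure.real N ≤ R ^ 2 / (4 + (κ : ℝ)) := by
    intro n
    have hle := integral_untopA_min_le h1 h2 hκ hx hR (n : ℝ≥0)
    refine le_trans ?_ hle
    have hτm := measurable_untopA_min h1 h2 hκ hx hR (n : ℝ≥0)
    have hτint : Integrable (fun ω ↦ (((min ((n : ℝ≥0) : WithTop ℝ≥0)
        (sleExitTime κ x 0 R ω)).untopA : ℝ≥0) : ℝ)) Process.preWienerMeasure :=
      (integrable_const ((n : ℝ≥0) : ℝ)).mono' hτm.aestronglyMeasurable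
        (ae_of_all _ fun ω ↦ by
          rw [Real.norm_eq_abs, abs_of_nonneg (NNReal.coe_nonneg _)]
          exact_mod_cast Literature.Analysis.FunctionSpaces.untopA_min_le (n : ℝ≥0) _)
    have hind : ∫ ω, N.indicator (fun _ ↦ (n : ℝ)) ω ∂Process.preWienerMeasure = (n : ℝ) * Process.preWienerMeasure.real N := by
      rw [integral_indicator_const _ hN, smul_eq_mul, mul_comm]
    rw [← hind]
    refine integral_mono ((integrable_const (n : ℝ)).indicator hN) hτint fun ω ↦ ?_
    by_cases hω : ω ∈ N
    · rw [indicator_of_mem hω, untopA_min_of_eq_top _ (show sleExitTime κ x 0 R ω = ⊤ from hω)]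
      push_cast; exact le_rfl
    · rw [indicator_of_notMem hω]; exact NNReal.coe_nonneg _
  have hN0 : Process.preWienerMeasure.real N = 0 := by
    by_contra hne
    have hpos : 0 < Process.preWienerMeasure.real N := lt_of_le_of_ne measureReal_nonneg (Ne.symm hne)
    obtain ⟨n, hn⟩ := exists_nat_gt (R ^ 2 / (4 + (κ : ℝ)) / Process.preWienerMeasure.real N)
    have h1 := hbound n
    rw [div_lt_iff₀ hpos] at hn
    linarith
  rw [ae_iff]
  have : {ω : ℝ≥0 → ℝ | ¬ sleExitTime κ x 0 R ω < ⊤} = N := by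
    ext ω; simp [hNdef]
  rw [this]
  exact (measureReal_eq_zero_iff (measure_ne_top _ _)).1 hN0


/-! ### Step 3: optional stopping for the power martingale, `P{X_σ = R} = (x/R)^{1-4/κ}` -/

/-- The **exit value** `X_σ` of the frozen flow from `(0, R)` (junk when `σ = ⊤`). [folklore] -/
theorem exitValue_mem (hx : 0 < x) (hR : x < R) {ω : ℝ≥0 → ℝ} {b : ℝ≥0}
    (hb : sleExitTime κ x 0 R ω = b) :
    realFlowStop (sleDriving κ ω) x b = 0 ∨ realFlowStop (sleDriving κ ω) x b = R :=
  realFlowStop_exitTime (continuous_sleDriving κ ω) (by rwa [sleDriving_zero])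
    (by rw [sleDriving_zero, sub_zero]; exact hR) hb

/-- After the (finite) exit time the stopped flow is frozen at the exit value. [folklore] -/
theorem stoppedProcess_eq_exitValue {ω : ℝ≥0 → ℝ} {b : ℝ≥0} (hb : sleExitTime κ x 0 R ω = b)
    {n : ℝ≥0} (hn : b ≤ n) :
    stoppedProcess (sleRealFlowStop κ x) (sleExitTime κ x 0 R) n ω = realFlowStop (sleDriving κ ω) x b := by
  rw [stoppedProcess_eq_of_ge (by rw [hb]; exact_mod_cast hn), hb, WithTop.untopA_eq_untop
    WithTop.coe_ne_top, WithTop.untop_coe, sleRealFlowStop]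

/-- **`P{σ < ∞, X_σ = R} = (x/R)^{1-4/κ}`** (Lawler (2005), proof of Prop. 1.21 with `x₁ → 0+`:
"`P{X_σ = x₂} = E[M_∞ | 𝓕₀] = φ₀(x; x₁, x₂)`"): `E[X^q_{n∧σ}] = x^q` for all `n`, `X^q_{n∧σ} → X^q_σ`
a.s. (eventually equal, `σ < ∞` a.s.), `0 ≤ X^q_{n∧σ} ≤ R^q`, dominated convergence, and
`X_σ ∈ {0, R}`. The event is null-measurable. [cite: Lawler2005, Prop. 1.21] -/
theorem measureReal_exit_at_level (h1 : sle_martingale_onePointPow) (h2 : sle_martingale_onePointSq)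
    (hκ : 4 < κ) (hx : 0 < x) (hR : x < R) :
    Process.preWienerMeasure.real {ω | ∃ b : ℝ≥0, sleExitTime κ x 0 R ω = b ∧
        realFlowStop (sleDriving κ ω) x b = R} = (x / R) ^ (1 - 4 / (κ : ℝ)) ∧
      NullMeasurableSet {ω | ∃ b : ℝ≥0, sleExitTime κ x 0 R ω = b ∧
        realFlowStop (sleDriving κ ω) x b = R} Process.preWienerMeasure := by
  haveI := isProbabilityMeasure_preWienerMeasure'
  have hκ4 : (4 : ℝ) < κ := by exact_mod_cast hκ
  set q : ℝ := 1 - 4 / (κ : ℝ) with hqdef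
  have hq : 0 < q := by rw [hqdef, sub_pos, div_lt_one (by linarith)]; exact hκ4
  have hM := h1 hκ le_rfl hx hR
  set Pw : ℕ → (ℝ≥0 → ℝ) → ℝ := fun n ↦ sleOnePointPow κ x 0 R n with hPw
  set V : (ℝ≥0 → ℝ) → ℝ := fun ω ↦
    realFlowStop (sleDriving κ ω) x (sleExitTime κ x 0 R ω).untopA with hVdef
  set B : Set (ℝ≥0 → ℝ) := {ω | ∃ b : ℝ≥0, sleExitTime κ x 0 R ω = b ∧
    realFlowStop (sleDriving κ ω) x b = R} with hBdef
  have hfin := ae_sleExitTime_lt_top h1 h2 hκ hx hR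
  have hmeasPw : ∀ n, Measurable (Pw n) := fun n ↦
    ((hM.stronglyMeasurable _).mono (brownianFiltration.le _)).measurable
  -- expectation is constant `x^q`
  have hint : ∀ n, ∫ ω, Pw n ω ∂Process.preWienerMeasure = x ^ q := by
    intro n
    simp only [hPw]
    rw [integral_eq_of_martingale hM]
    simp_rw [sleOnePointPow_zero (κ := κ) hx R]
    rw [integral_const, smul_eq_mul, probReal_univ, one_mul]
  -- on `{σ = b < ⊤}`: `V = X_b`, eventually `Pw n = V^q`
  have hV : ∀ ω (b : ℝ≥0), sleExitTime κ x 0 R ω = b → V ω = realFlowStop (sleDriving κ ω) x b := by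
    intro ω b hb
    simp only [hVdef]
    rw [hb, WithTop.untopA_eq_untop WithTop.coe_ne_top, WithTop.untop_coe]
  have hev : ∀ ω (b : ℝ≥0), sleExitTime κ x 0 R ω = b → ∀ᶠ n : ℕ in atTop, Pw n ω = V ω ^ q := by
    intro ω b hb
    obtain ⟨N, hN⟩ := exists_nat_ge (b : ℝ)
    filter_upwards [eventually_ge_atTop N] with n hn
    have hbn : b ≤ (n : ℝ≥0) := by
      rw [← NNReal.coe_le_coe]; push_cast; exact hN.trans (by exact_mod_cast hn)
    simp only [hPw, sleOnePointPow]
    rw [stoppedProcess_eq_exitValue hb hbn, hV ω b hb]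
  have hlim : ∀ᵐ ω ∂Process.preWienerMeasure, Tendsto (fun n ↦ Pw n ω) atTop (𝓝 (V ω ^ q)) := by
    filter_upwards [hfin] with ω hω
    obtain ⟨b, hb⟩ := WithTop.ne_top_iff_exists.1 hω.ne
    exact tendsto_const_nhds.congr' ((hev ω b hb.symm).mono fun n hn ↦ hn.symm)
  have hbound : ∀ n, ∀ᵐ ω ∂Process.preWienerMeasure, ‖Pw n ω‖ ≤ R ^ q := fun n ↦ ae_of_all _ fun ω ↦ by
    have hm := sleOnePointPow_mem_Icc hκ hx hR (n : ℝ≥0) ω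
    rw [Real.norm_eq_abs, abs_of_nonneg hm.1]; exact hm.2
  have hdct := tendsto_integral_of_dominated_convergence (fun _ ↦ R ^ q)
    (fun n ↦ (hmeasPw n).aestronglyMeasurable) (integrable_const _) hbound hlim
  have hVq : ∫ ω, V ω ^ q ∂Process.preWienerMeasure = x ^ q :=
    tendsto_nhds_unique hdct (by simp only [hint]; exact tendsto_const_nhds)
  -- `V` is a.e.-measurable, `B` is null-measurable
  have hlimV : ∀ᵐ ω ∂Process.preWienerMeasure, Tendsto (fun n : ℕ ↦
      stoppedProcess (sleRealFlowStop κ x) (sleExitTime κ x 0 R) n ω) atTop (𝓝 (V ω)) := by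
    filter_upwards [hfin] with ω hω
    obtain ⟨b, hb⟩ := WithTop.ne_top_iff_exists.1 hω.ne
    obtain ⟨N, hN⟩ := exists_nat_ge (b : ℝ)
    refine tendsto_const_nhds.congr' ?_
    filter_upwards [eventually_ge_atTop N] with n hn
    have hbn : b ≤ (n : ℝ≥0) := by
      rw [← NNReal.coe_le_coe]; push_cast; exact hN.trans (by exact_mod_cast hn)
    rw [stoppedProcess_eq_exitValue hb.symm hbn, hV ω b hb.symm]
  have hVm : AEMeasurable V Process.preWienerMeasure :=
    aemeasurable_of_tendsto_metrizable_ae (f := fun (n : ℕ) ω ↦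
        stoppedProcess (sleRealFlowStop κ x) (sleExitTime κ x 0 R) (n : ℝ≥0) ω) atTop
      (fun n ↦ (measurable_stoppedProcess_sleRealFlowStop h1 hκ hx hR (n : ℝ≥0)).aemeasurable) hlimV
  have hN : MeasurableSet {ω | sleExitTime κ x 0 R ω = ⊤} := measurableSet_sleExitTime_eq_top h1 h2 hκ hx hR
  have hBeq : B = {ω | sleExitTime κ x 0 R ω = ⊤}ᶜ ∩ V ⁻¹' {R} := by
    ext ω
    simp only [hBdef, mem_setOf_eq, mem_inter_iff, mem_compl_iff, mem_preimage, mem_singleton_iff]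
    constructor
    · rintro ⟨b, hb, hVb⟩
      exact ⟨by rw [hb]; exact WithTop.coe_ne_top, by rw [hV ω b hb]; exact hVb⟩
    · rintro ⟨hne, hVR⟩
      obtain ⟨b, hb⟩ := WithTop.ne_top_iff_exists.1 hne
      exact ⟨b, hb.symm, by rw [← hV ω b hb.symm]; exact hVR⟩
  have hBnull : NullMeasurableSet B Process.preWienerMeasure := by
    rw [hBeq]
    exact hN.compl.nullMeasurableSet.inter (hVm.nullMeasurableSet_preimage (measurableSet_singleton R))
  refine ⟨?_, hBnull⟩
  -- `V^q = R^q 𝟙_B` a.e.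
  have hae : (fun ω ↦ V ω ^ q) =ᵐ[Process.preWienerMeasure] B.indicator fun _ ↦ R ^ q := by
    filter_upwards [hfin] with ω hω
    obtain ⟨b, hb⟩ := WithTop.ne_top_iff_exists.1 hω.ne
    rcases exitValue_mem (κ := κ) hx hR hb.symm with h0 | hRv
    · have hnot : ω ∉ B := by
        rintro ⟨b', hb', hVb'⟩
        rw [← hb] at hb'
        have : b = b' := by exact_mod_cast hb'
        subst this
        rw [h0] at hVb'
        linarith
      rw [indicator_of_notMem hnot, hV ω b hb.symm, h0, Real.zero_rpow hq.ne']
    · have hmem : ω ∈ B := ⟨b, hb.symm, hRv⟩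
      rw [indicator_of_mem hmem, hV ω b hb.symm, hRv]
  rw [integral_congr_ae hae] at hVq
  -- replace `B` by its measurable hull
  have hBB' : (toMeasurable Process.preWienerMeasure B : Set (ℝ≥0 → ℝ)) =ᵐ[Process.preWienerMeasure] B :=
    hBnull.toMeasurable_ae_eq
  rw [← integral_congr_ae (indicator_ae_eq_of_ae_eq_set hBB'), integral_indicator_const _
    (measurableSet_toMeasurable _ _), smul_eq_mul, measureReal_def, measure_toMeasurable,
    ← measureReal_def] at hVq
  have hRq : 0 < R ^ q := Real.rpow_pos_of_pos (hx.trans hR) q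
  rw [Real.div_rpow hx.le (hx.trans hR).le, eq_div_iff hRq.ne']
  exact hVq

/-! ### Step 4: a.s. swallowing -/

/-- **`P{T_x = ∞} ≤ (x/R)^{1-4/κ}`** for every `R > x` (`κ > 4`): on `{T_x = ∞}`, a.s. `σ_R < ∞`
and then the exit from `(0, R)` is through the level `R`. [cite: Lawler2005, Prop. 1.21] -/
theorem measureReal_swallowingTime_eq_top_le (h1 : sle_martingale_onePointPow)
    (h2 : sle_martingale_onePointSq) (hκ : 4 < κ) (hx : 0 < x) (hR : x < R) :
    Process.preWienerMeasure.real {ω | swallowingTime (sleDriving κ ω) x = ⊤} ≤ (x / R) ^ (1 - 4 / (κ : ℝ)) := by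
  haveI := isProbabilityMeasure_preWienerMeasure'
  obtain ⟨hB, -⟩ := measureReal_exit_at_level h1 h2 hκ hx hR
  set B : Set (ℝ≥0 → ℝ) := {ω | ∃ b : ℝ≥0, sleExitTime κ x 0 R ω = b ∧
    realFlowStop (sleDriving κ ω) x b = R} with hBdef
  set N : Set (ℝ≥0 → ℝ) := {ω | sleExitTime κ x 0 R ω = ⊤} with hNdef
  have hN0 : Process.preWienerMeasure N = 0 := by
    have := ae_iff.1 (ae_sleExitTime_lt_top h1 h2 hκ hx hR)
    have hset : {ω : ℝ≥0 → ℝ | ¬ sleExitTime κ x 0 R ω < ⊤} = N := by ext ω; simp [hNdef]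
    rwa [hset] at this
  have hsub : {ω : ℝ≥0 → ℝ | swallowingTime (sleDriving κ ω) x = ⊤} ⊆ B ∪ N := by
    intro ω hT
    by_cases hσ : sleExitTime κ x 0 R ω = ⊤
    · exact Or.inr hσ
    · obtain ⟨b, hb⟩ := WithTop.ne_top_iff_exists.1 hσ
      refine Or.inl ⟨b, hb.symm, ?_⟩
      exact realFlowStop_exitTime_of_top (continuous_sleDriving κ ω) (by rwa [sleDriving_zero])
        (by rw [sleDriving_zero, sub_zero]; exact hR) hT hb.symm
  calc Process.preWienerMeasure.real {ω | swallowingTime (sleDriving κ ω) x = ⊤}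
      ≤ Process.preWienerMeasure.real (B ∪ N) := measureReal_mono hsub
    _ ≤ Process.preWienerMeasure.real B + Process.preWienerMeasure.real N := measureReal_union_le _ _
    _ = (x / R) ^ (1 - 4 / (κ : ℝ)) := by
        rw [hB, measureReal_def, hN0, ENNReal.toReal_zero, add_zero]

/-- **A.s. swallowing of positive reals for `κ > 4` from the one-point Itô steps** (Lawler (2005),
Prop. 6.8 / Prop. 1.21: "if `a < 1/2`, then w.p.1 `T_x < ∞`"; Rohde–Schramm (2005), Lemma 6.5): for
`κ > 4` and `x > 0`, almost surely `T_x < ∞`. From `P{T_x = ∞} ≤ (x/R)^{1-4/κ}` for all `R > x`.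
This is the direction of `sle_swallows_real_iff` used by Cardy's formula. [cite: Lawler2005, Prop. 6.8] -/
theorem sle_swallowingTime_lt_top_of_onePointMartingales (h1 : sle_martingale_onePointPow)
    (h2 : sle_martingale_onePointSq) :
    ∀ ⦃κ : ℝ≥0⦄, 4 < κ → ∀ ⦃x : ℝ⦄, 0 < x →
      ∀ᵐ ω ∂Process.preWienerMeasure, swallowingTime (sleDriving κ ω) x < ⊤ := by
  intro κ hκ x hx
  haveI := isProbabilityMeasure_preWienerMeasure'
  have hκ4 : (4 : ℝ) < κ := by exact_mod_cast hκ
  set q : ℝ := 1 - 4 / (κ : ℝ) with hqdef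
  have hq : 0 < q := by rw [hqdef, sub_pos, div_lt_one (by linarith)]; exact hκ4
  have hle : ∀ ε : ℝ, 0 < ε → ε < 1 →
      Process.preWienerMeasure.real {ω | swallowingTime (sleDriving κ ω) x = ⊤} ≤ ε := by
    intro ε hε hε1
    set c : ℝ := (1 / ε) ^ q⁻¹ with hc
    have hc1 : 1 < c := Real.one_lt_rpow (by rw [lt_div_iff₀ hε]; linarith) (inv_pos.2 hq)
    have hc0 : 0 < c := zero_lt_one.trans hc1
    have hR : x < x * c := lt_mul_of_one_lt_right hx hc1
    have h := measureReal_swallowingTime_eq_top_le h1 h2 hκ hx hR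
    have hval : (x / (x * c)) ^ q = ε := by
      rw [div_mul_cancel_left₀ hx.ne', Real.inv_rpow hc0.le, hc,
        Real.rpow_inv_rpow (by positivity) hq.ne', one_div, inv_inv]
    rwa [hval] at h
  have h0 : Process.preWienerMeasure.real {ω | swallowingTime (sleDriving κ ω) x = ⊤} = 0 := by
    apply le_antisymm _ measureReal_nonneg
    by_contra hpos
    rw [not_le] at hpos
    have h := hle (min (1 / 2) (Process.preWienerMeasure.real {ω | swallowingTime (sleDriving κ ω) x = ⊤} / 2))
      (lt_min one_half_pos (half_pos hpos)) (lt_of_le_of_lt (min_le_left _ _) (by norm_num))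
    have := min_le_right (1 / 2 : ℝ) (Process.preWienerMeasure.real {ω | swallowingTime (sleDriving κ ω) x = ⊤} / 2)
    linarith
  rw [ae_iff]
  have hset : {ω : ℝ≥0 → ℝ | ¬ swallowingTime (sleDriving κ ω) x < ⊤} =
      {ω | swallowingTime (sleDriving κ ω) x = ⊤} := by ext ω; simp
  rw [hset]
  exact (measureReal_eq_zero_iff (measure_ne_top _ _)).1 h0

/-- **Lawler's Prop. 6.8 (uniform in `x`) from the one-point Itô steps**: the named fact
`Literature.Probability.RandomPlanarGeometry.sle_swallowingTime_ofReal_lt_top` of `SLEBoundaryHitting` (for `κ > 4`, w.p.1 `T_x < ∞` for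
*all* `x > 0`) follows, through countably many points and the monotonicity of `x ↦ T_x`
(`Loewner.swallowingTime_mono_right`). [cite: Lawler2005, Prop. 6.8] -/
theorem sle_swallowingTime_ofReal_lt_top_of_onePointMartingales (h1 : sle_martingale_onePointPow)
    (h2 : sle_martingale_onePointSq) : sle_swallowingTime_ofReal_lt_top := by
  intro κ hκ
  have hn : ∀ n : ℕ, ∀ᵐ ω ∂Process.preWienerMeasure,
      swallowingTime (sleDriving κ ω) ((n + 1 : ℕ) : ℝ) < ⊤ := fun n ↦
    sle_swallowingTime_lt_top_of_onePointMartingales h1 h2 hκ (by positivity)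
  filter_upwards [ae_all_iff.2 hn] with ω hω x hx
  obtain ⟨n, hn⟩ := exists_nat_gt x
  refine lt_of_le_of_lt ?_ (hω n)
  have hle : x ≤ ((n + 1 : ℕ) : ℝ) := by push_cast; linarith
  have := swallowingTime_mono_right (W := sleDriving κ ω) (continuous_sleDriving κ ω)
    (x := x) (x' := ((n + 1 : ℕ) : ℝ)) (by rw [sleDriving_zero]; exact hx) hle
  simpa using this

/-- **Cardy's formula for SLE₆ in a conformal rectangle from three Itô steps**: the target
`CritPerc.sle_six_measureReal_hitsBefore` (`CritPercSLE`) follows from Lawler's two-point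
martingale (`sle_martingale_twoPointObservable`, the Itô step of Prop. 6.33) and the two one-point
martingales (`sle_martingale_onePointPow`, `sle_martingale_onePointSq`, the Itô steps of
Prop. 1.21 / 6.8); every other ingredient is proved in `Literature`. [cite: Lawler2005, Prop. 6.33] -/
theorem sle_six_measureReal_hitsBefore_of_itoSteps (hS : sle_martingale_twoPointObservable)
    (h1 : sle_martingale_onePointPow) (h2 : sle_martingale_onePointSq) :
    RandomPlanarGeometry.sle_six_measureReal_hitsBefore :=
  RandomPlanarGeometry.sle_six_measureReal_hitsBefore_of_martingale_of_ae hS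
    (sle_swallowingTime_lt_top_of_onePointMartingales h1 h2)

end SLE

end Literature.Probability.RandomPlanarGeometry
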